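import Literature.NumberTheory.EllipticCurves.AnticyclotomicRankinSelbergPAdicLFunction
import Mathlib.Analysis.SpecialFunctions.Pow.Real
import HarnessLib

/-!
# X11b @ `p = 3`, S18(b) GLUE: Hsieh's display ⟷ Castella's display by a real period rescaling, and the
# PINNED `R₀`-form ⟹ the `R₀`-frame (team N8/O2 = cell `b2b-bsdres`, sub-target S18(b), seat x11b3-p7)

HONEST FRAMING (cell `b2b-bsdres`, run/shared/lean/b2b/bsd-rank1-residual/, verbatim in every
file): the goal of the cell is to DELETE the COMBINATION-SHAPED residual classes of the
Birch–Swinnerton-Dyer formula for ALL analytic-rank `≤ 1` elliptic curves over `ℚ` — assembled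
STRICTLY from published theorems — so that the rank-`≤ 1` remainder becomes exactly the
CONSTRUCTION-SHAPED classes, which are TYPED, NOT attempted. This is not "finishing BSD". Team N8/O2
(X11b at `3`: `3 ‖ N`, `r_an = 1`, `E[3]` irreducible): research route; nothing booked; NO label
changes; O2 stays OPEN. THEOREMS ONLY: no definition, no named fact, no `sorry`.

PROVENANCE: sub-target S18(b) (OWNERS R7-22 / R7-27 / R7-37 / R7-41; lead x11b3 GEN 6), seat
`b2b-bsdres-x11b3-p7` (gen. 3). Consumer: `X11b/Three/BDPExistsFromPrint.lean` (the named residual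
`Three.HsiehFrameResidualAt₃` and the assembly `Three.bdpExistsAt₃_of_hsieh2014`). Source of the display:
the Literature fact `hsieh2014_exists_anticyclotomicPAdicLFunction` (Hsieh 2014 Thm. 1 typed in Hsieh's
frame with CM type `{σ̄₀}`, seat lit1's proposal; its `hsiehInterpolationValue` is PROVED there to be
`C · p^{n[p∣N]}/(A^{2n}4^{2n})` times `bdpInterpolationValue`).

## What is proved (elementary; r2's glue items (g1)/(g4) of `gen6/D3EPS.md` §4.1)

* `bdpInterpolationValue_periodRescale`: `bdp(c·Ω_K) = (c⁴)^{−n} · bdp(Ω_K)` (the value is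
  `X/(π^{2n+1}Ω_K^{4n})`);
* `hsiehInterpolationValue_eq_bdpInterpolationValue_rescale`: if `p ∣ N` and `c⁴ = 16A²/p` then
  `hsieh(A, Ω_K', C := 1) = bdp(c·Ω_K')` — Hsieh's archimedean factor `Γ(n)Γ(n+1)/((Im δ)^{2n}(4π)^{2n+1})`
  and the `p`-power `p^{n}` of the Steinberg root number differ from Castella's `Γ(n)Γ(n+1)/π^{2n+1}` by
  the REAL monomial `(p/(16A²))^{n}`, absorbed by the complex period; `exists_pos_pow_four_eq` supplies
  the real fourth root;
* `exists_isBDPLFunction_of_hsiehDisplay`: an `R₀`-frame `(Ω_K', Ω_p', L)` realising HSIEH's display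
  (constant `1`) on the range ⟹ `IsBDPLFunction ι' 𝔭 κ γ f Ω_K₁ Ω_p' L` with `Ω_K₁ = (16A²/3)^{1/4}Ω_K'`;
  `hsiehDisplay_of_isBDPLFunction`: the converse (`Ω_K' := Ω_K₁/(16A²/3)^{1/4}`) — so asking for an
  `R₀`-frame in Hsieh's display is asking for EXACTLY a tree frame with `Ω_p ∈ R₀ˣ`, `L ∈ R₀⟦T⟧`;
* `hsiehInterpolationValue_const` (linearity in `C`) and `hsiehDisplayFrame_of_coeff_mem`: the PINNED
  statement "(t1) every coefficient of Hsieh's `Q` lies in `R₀`, (t2) `Ω_p ∈ R₀ˣ`, (t3) `ι'⁻¹C ∈ R₀ˣ`"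
  yields the `R₀`-frame with Hsieh's display at constant `1` (`L := (ι'⁻¹C)⁻¹·Q` read in `R₀⟦T⟧`,
  `Ω_p' := Ω_p`) — the natural target of a future construction, and the calibration showing that the
  consumer's residual (stated in the invariant `∃`-re-normalisation form) is no stronger than it.

## References

* [Hsieh2014] M.-L. Hsieh, Doc. Math. 19 (2014), Thm. 1 (arXiv:1112.1580 pp. 3–4).
* [Castella2018] F. Castella, Camb. J. Math. 6 (2018), Thm. 3.1 (arXiv:1704.06608 p. 9).
* Cell files: `cells/x11b3/OWNERS.md` R7-41; r2 `gen6/D3EPS.md` §4.1, `gen6/G1-REVIEW.md`.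
-/

noncomputable section

open scoped Classical

open NumberField IsDedekindDomain Field
  Literature.NumberTheory.EllipticCurves Literature.NumberTheory.EllipticCurves.ModularForms
  Literature.NumberTheory.GaloisRepresentations

namespace Summit.BirchSwinnertonDyer.Rank1Residual.X11b.Three

/-! ### Glue (g1): the period rescaling that turns Hsieh's display into Castella's -/

section Glue

variable {K : Type} [Field K] [NumberField K] {N : ℕ}

/-- **(g1) Period rescaling**: Castella's display scales by `c^{−4n}` under `Ω_K ↦ c·Ω_K`:
`bdpInterpolationValue p f 𝔭 χ n (c Ω_K) = (c^4)^{−n} · bdpInterpolationValue p f 𝔭 χ n Ω_K` (the value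
is `X/(π^{2n+1} Ω_K^{4n})`). [cite: Castella2018, Thm. 3.1 (arXiv:1704.06608 p. 9)] -/
theorem bdpInterpolationValue_periodRescale (p : ℕ) (f : CuspForm (CongruenceSubgroup.Gamma0 N) 2)
    (𝔭 : HeightOneSpectrum (𝓞 K)) (χ : HeckeCharacter K) (n : ℕ) (ΩK c : ℂ) (hc : c ≠ 0) :
    bdpInterpolationValue p f 𝔭 χ n (c * ΩK) =
      ((c ^ 4) ^ n)⁻¹ * bdpInterpolationValue p f 𝔭 χ n ΩK := by
  unfold bdpInterpolationValue
  simp only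
  have h4 : (c * ΩK) ^ (4 * n) = (c ^ 4) ^ n * ΩK ^ (4 * n) := by rw [mul_pow, pow_mul]
  rw [h4]
  have hcn : (c ^ 4) ^ n ≠ 0 := pow_ne_zero _ (pow_ne_zero _ hc)
  field_simp

/-- **(g1) Hsieh's display IS Castella's display at the rescaled period** `Ω_K₁ = c·Ω_K'` whenever
`c^4 = 16 A²/p` (at `p ∣ N`): `hsiehInterpolationValue p f 𝔭 χ n A Ω_K' = bdpInterpolationValue p f 𝔭
χ n (c·Ω_K')` — the real monomial `(p/(16A²))^{n}` of Hsieh's archimedean factor and Steinberg root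
number is absorbed by the complex period. [cite: Hsieh2014, Thm. 1 (arXiv:1112.1580 p. 4)] -/
theorem hsiehInterpolationValue_eq_bdpInterpolationValue_rescale {p : ℕ} (hpN : p ∣ N)
    (hp : (p : ℂ) ≠ 0) (f : CuspForm (CongruenceSubgroup.Gamma0 N) 2) (𝔭 : HeightOneSpectrum (𝓞 K))
    (χ : HeckeCharacter K) (n : ℕ) {A : ℝ} (hA : A ≠ 0) (ΩK' c : ℂ) (hc : c ≠ 0)
    (hc4 : c ^ 4 = 16 * (A : ℂ) ^ 2 / (p : ℂ)) :
    hsiehInterpolationValue p f 𝔭 χ n A ΩK' 1 = bdpInterpolationValue p f 𝔭 χ n (c * ΩK') := by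
  rw [bdpInterpolationValue_periodRescale p f 𝔭 χ n ΩK' c hc,
    hsiehInterpolationValue_eq_mul_bdpInterpolationValue, if_pos hpN, hc4, one_mul]
  congr 1
  have hA' : (A : ℂ) ≠ 0 := Complex.ofReal_ne_zero.mpr hA
  have h16 : (4 : ℂ) ^ (2 * n) = (16 : ℂ) ^ n := by
    rw [pow_mul]; norm_num
  rw [h16, div_pow, inv_div, mul_pow, ← pow_mul]
  field_simp

/-- **A real positive fourth root**: for `0 < x` there is `c : ℝ` with `0 < c` and `c^4 = x`
(`c = x^{1/4}`, `Real.rpow`). [folklore] -/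
theorem exists_pos_pow_four_eq {x : ℝ} (hx : 0 < x) : ∃ c : ℝ, 0 < c ∧ c ^ 4 = x := by
  refine ⟨x ^ ((4 : ℝ)⁻¹), Real.rpow_pos_of_pos hx _, ?_⟩
  rw [← Real.rpow_natCast, ← Real.rpow_mul hx.le]
  norm_num

variable [Fact (Nat.Prime 3)]

/-- **From an `R₀`-frame realising HSIEH's display to `IsBDPLFunction`** (glue (g1) assembled): if
`L ∈ R₀⟦T⟧` takes at every `χ` of the range the value `ι'⁻¹(hsiehInterpolationValue 3 f 𝔭 χ n A Ω_K' 1)·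
Ω_p'^{4n}` (constant `C = 1`) with `A > 0`, `Ω_K' ≠ 0`, and `3 ∣ N`, then `IsBDPLFunction ι' 𝔭 κ γ f
Ω_K₁ Ω_p' L` for
`Ω_K₁ = (16A²/3)^{1/4}·Ω_K' ≠ 0`. [cite: Hsieh2014, Thm. 1 (arXiv:1112.1580 p. 4)] [cite: Castella2018, Thm. 3.1 (arXiv:1704.06608 p. 9)] -/
theorem exists_isBDPLFunction_of_hsiehDisplay (ι' : PadicAlgCl 3 ≃+* ℂ) (𝔭 : HeightOneSpectrum (𝓞 K))
    (κ : ZpExtension K 3) (γ : Field.absoluteGaloisGroup K) [NeZero N]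
    (f : CuspForm (CongruenceSubgroup.Gamma0 N) 2) (h3N : 3 ∣ N) {A : ℝ} (hA : 0 < A) {ΩK' : ℂ}
    (hΩK' : ΩK' ≠ 0) (Ωp' : ℂ_[3]) (L : UnrSeries 3)
    (hL : ∀ (χ : HeckeCharacter K) (n : ℕ), 0 < n →
      (∀ v : HeightOneSpectrum (𝓞 K), χ.IsUnramifiedAt v) →
      χ.HasInfinityType (fun _ ↦ (n : ℤ)) (fun _ ↦ -(n : ℤ)) →
      ∀ r : FramedGaloisRep K (PadicAlgCl 3) 1, IsPAdicAvatarOf ι' χ r → FactorsThroughZp κ r →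
        L.HasValueAt (avatarValueAt r γ - 1)
          (((ι'.symm (hsiehInterpolationValue 3 f 𝔭 χ n A ΩK' 1) : PadicAlgCl 3) : ℂ_[3]) *
            Ωp' ^ (4 * n))) :
    ∃ ΩK₁ : ℂ, ΩK₁ ≠ 0 ∧ IsBDPLFunction ι' 𝔭 κ γ f ΩK₁ Ωp' L := by
  obtain ⟨c, hc, hc4⟩ := exists_pos_pow_four_eq (x := 16 * A ^ 2 / 3) (by positivity)
  have hcC : (c : ℂ) ≠ 0 := Complex.ofReal_ne_zero.mpr hc.ne'
  have hc4C : (c : ℂ) ^ 4 = 16 * (A : ℂ) ^ 2 / ((3 : ℕ) : ℂ) := by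
    have := congrArg (fun t : ℝ ↦ (t : ℂ)) hc4
    push_cast at this ⊢
    exact this
  refine ⟨(c : ℂ) * ΩK', mul_ne_zero hcC hΩK', ?_⟩
  intro χ n hn hunr hinf r hr hκ
  have h := hL χ n hn hunr hinf r hr hκ
  rwa [hsiehInterpolationValue_eq_bdpInterpolationValue_rescale h3N (by norm_num) f 𝔭 χ n hA.ne'
    ΩK' (c : ℂ) hcC hc4C] at h

/-- **Converse of the glue (calibration of the residual)**: an `R₀`-frame in CASTELLA's display
yields, for every `A > 0`, an `R₀`-frame in HSIEH's display (`Ω_K' := Ω_K₁/(16A²/3)^{1/4}`). Hence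
the rationality clause of `HsiehFrameResidualAt₃` asks for NOTHING MORE than a tree frame
`IsBDPLFunction ι' 𝔭 κ γ f Ω_K₁ Ω_p' L` with `Ω_p' ∈ R₀ˣ`, `L ∈ R₀⟦T⟧` for the datum — it is the
`R₀`-descent and not a new interpolation property. [cite: Castella2018, Thm. 3.1 (arXiv:1704.06608 p. 9)] -/
theorem hsiehDisplay_of_isBDPLFunction (ι' : PadicAlgCl 3 ≃+* ℂ) (𝔭 : HeightOneSpectrum (𝓞 K))
    (κ : ZpExtension K 3) (γ : Field.absoluteGaloisGroup K) [NeZero N]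
    (f : CuspForm (CongruenceSubgroup.Gamma0 N) 2) (h3N : 3 ∣ N) {A : ℝ} (hA : 0 < A) {ΩK₁ : ℂ}
    (hΩK₁ : ΩK₁ ≠ 0) (Ωp' : ℂ_[3]) (L : UnrSeries 3) (hL : IsBDPLFunction ι' 𝔭 κ γ f ΩK₁ Ωp' L) :
    ∃ ΩK' : ℂ, ΩK' ≠ 0 ∧ ∀ (χ : HeckeCharacter K) (n : ℕ), 0 < n →
      (∀ v : HeightOneSpectrum (𝓞 K), χ.IsUnramifiedAt v) →
      χ.HasInfinityType (fun _ ↦ (n : ℤ)) (fun _ ↦ -(n : ℤ)) →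
      ∀ r : FramedGaloisRep K (PadicAlgCl 3) 1, IsPAdicAvatarOf ι' χ r → FactorsThroughZp κ r →
        L.HasValueAt (avatarValueAt r γ - 1)
          (((ι'.symm (hsiehInterpolationValue 3 f 𝔭 χ n A ΩK' 1) : PadicAlgCl 3) : ℂ_[3]) *
            Ωp' ^ (4 * n)) := by
  obtain ⟨c, hc, hc4⟩ := exists_pos_pow_four_eq (x := 16 * A ^ 2 / 3) (by positivity)
  have hcC : (c : ℂ) ≠ 0 := Complex.ofReal_ne_zero.mpr hc.ne'
  have hc4C : (c : ℂ) ^ 4 = 16 * (A : ℂ) ^ 2 / ((3 : ℕ) : ℂ) := by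
    have := congrArg (fun t : ℝ ↦ (t : ℂ)) hc4
    push_cast at this ⊢
    exact this
  refine ⟨ΩK₁ / (c : ℂ), div_ne_zero hΩK₁ hcC, ?_⟩
  intro χ n hn hunr hinf r hr hκ
  have h := hL χ n hn hunr hinf r hr hκ
  rwa [hsiehInterpolationValue_eq_bdpInterpolationValue_rescale h3N (by norm_num) f 𝔭 χ n hA.ne'
    (ΩK₁ / (c : ℂ)) (c : ℂ) hcC hc4C, mul_div_cancel₀ _ hcC]

omit [Fact (Nat.Prime 3)] in
/-- `hsiehInterpolationValue` is linear in its constant: the value with constant `C` is `C` times the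
value with constant `1`. [cite: Hsieh2014, Thm. 1 (arXiv:1112.1580 p. 4)] -/
theorem hsiehInterpolationValue_const (p : ℕ) (f : CuspForm (CongruenceSubgroup.Gamma0 N) 2)
    (𝔭 : HeightOneSpectrum (𝓞 K)) (χ : HeckeCharacter K) (n : ℕ) (A : ℝ) (ΩK C : ℂ) :
    hsiehInterpolationValue p f 𝔭 χ n A ΩK C = C * hsiehInterpolationValue p f 𝔭 χ n A ΩK 1 := by
  rw [hsiehInterpolationValue_eq_mul_bdpInterpolationValue,
    hsiehInterpolationValue_eq_mul_bdpInterpolationValue]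
  ring

/-- **The PINNED form discharges the residual's rationality clause** (the natural target of a future
construction): if a Hsieh witness `(A, Ω_K, C, Ω_p, Q)` has ALL coefficients of `Q` in `R₀ =
unrIntegers 3`, `Ω_p ∈ R₀ˣ` and `ι'⁻¹C ∈ R₀ˣ` — (t1), (t2), (t3) literally —, then an `R₀`-frame with
Hsieh's display at constant `1` exists: `Ω_K' := Ω_K`, `Ω_p' := Ω_p`, `L := (ι'⁻¹C)⁻¹ · Q` read in
`R₀⟦T⟧`. So `HsiehFrameResidualAt₃` (the invariant `∃`-re-normalisation form) is implied by, and no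
stronger than, the pinned statement whenever the latter holds of the witness at hand.
[cite: Hsieh2014, Thm. 1 (arXiv:1112.1580 pp. 3–4)] [cite: Castella2018, Thm. 3.1 (arXiv:1704.06608 p. 9) (R₀-frame)] -/
theorem hsiehDisplayFrame_of_coeff_mem (ι' : PadicAlgCl 3 ≃+* ℂ) (𝔭 : HeightOneSpectrum (𝓞 K))
    (κ : ZpExtension K 3) (γ : Field.absoluteGaloisGroup K) [NeZero N]
    (f : CuspForm (CongruenceSubgroup.Gamma0 N) 2) {A : ℝ} {ΩK C : ℂ} {Ωp : ℂ_[3]}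
    {Q : PowerSeries (PadicComplexInt 3)} (hQ : IsHsiehLFunction ι' 𝔭 κ γ f A ΩK C Ωp Q)
    (h1 : ∀ k : ℕ, ((PowerSeries.coeff k Q : PadicComplexInt 3) : ℂ_[3]) ∈ unrIntegers 3)
    (h2 : ∃ u : (unrIntegers 3)ˣ, ((u : unrIntegers 3) : ℂ_[3]) = Ωp)
    (h3 : ∃ c : (unrIntegers 3)ˣ, ((c : unrIntegers 3) : ℂ_[3]) = ((ι'.symm C : PadicAlgCl 3) : ℂ_[3])) :
    ∃ (Ωp' : (unrIntegers 3)ˣ) (L : UnrSeries 3),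
      ∀ (χ : HeckeCharacter K) (n : ℕ), 0 < n →
        (∀ v : HeightOneSpectrum (𝓞 K), χ.IsUnramifiedAt v) →
        χ.HasInfinityType (fun _ ↦ (n : ℤ)) (fun _ ↦ -(n : ℤ)) →
        ∀ r : FramedGaloisRep K (PadicAlgCl 3) 1, IsPAdicAvatarOf ι' χ r → FactorsThroughZp κ r →
          L.HasValueAt (avatarValueAt r γ - 1)
            (((ι'.symm (hsiehInterpolationValue 3 f 𝔭 χ n A ΩK 1) : PadicAlgCl 3) : ℂ_[3]) *
              ((Ωp' : unrIntegers 3) : ℂ_[3]) ^ (4 * n)) := by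
  obtain ⟨u, hu⟩ := h2
  obtain ⟨c, hc⟩ := h3
  -- `Q` read in `R₀⟦T⟧`, then rescaled by the unit `c⁻¹ = (ι'⁻¹C)⁻¹`
  let L₀ : UnrSeries 3 := PowerSeries.mk fun k ↦ ⟨_, h1 k⟩
  have hL₀ : ∀ k : ℕ, ((PowerSeries.coeff k Q : PadicComplexInt 3) : ℂ_[3]) =
      ((PowerSeries.coeff k L₀ : unrIntegers 3) : ℂ_[3]) := fun k ↦ by
    simp [L₀, PowerSeries.coeff_mk]
  refine ⟨u, PowerSeries.C ((c⁻¹ : (unrIntegers 3)ˣ) : unrIntegers 3) * L₀, ?_⟩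
  intro χ n hn hunr hinf r hr hκ
  have hv : IntSeries.HasValueAt Q (avatarValueAt r γ - 1)
      (((ι'.symm (hsiehInterpolationValue 3 f 𝔭 χ n A ΩK C) : PadicAlgCl 3) : ℂ_[3]) *
        Ωp ^ (4 * n)) := hQ χ n hn hunr hinf r hr hκ
  rw [IntSeries.hasValueAt_iff_of_coeff_eq hL₀] at hv
  -- rescale the `HasSum` by the unit `c⁻¹`
  have hscaled := hv.mul_left (((c⁻¹ : (unrIntegers 3)ˣ) : unrIntegers 3) : ℂ_[3])
  have hcoeff : ∀ k : ℕ, ((PowerSeries.coeff k (PowerSeries.C ((c⁻¹ : (unrIntegers 3)ˣ) :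
      unrIntegers 3) * L₀) : unrIntegers 3) : ℂ_[3]) =
      (((c⁻¹ : (unrIntegers 3)ˣ) : unrIntegers 3) : ℂ_[3]) *
        ((PowerSeries.coeff k L₀ : unrIntegers 3) : ℂ_[3]) := fun k ↦ by
    rw [PowerSeries.coeff_C_mul, Subring.coe_mul]
  have hfun : (fun k : ℕ ↦ ((PowerSeries.coeff k (PowerSeries.C ((c⁻¹ : (unrIntegers 3)ˣ) :
      unrIntegers 3) * L₀) : unrIntegers 3) : ℂ_[3]) * (avatarValueAt r γ - 1) ^ k) =
      (fun k : ℕ ↦ (((c⁻¹ : (unrIntegers 3)ˣ) : unrIntegers 3) : ℂ_[3]) *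
        (((PowerSeries.coeff k L₀ : unrIntegers 3) : ℂ_[3]) * (avatarValueAt r γ - 1) ^ k)) := by
    funext k
    rw [hcoeff, mul_assoc]
  -- the values agree: `c⁻¹ · ι'⁻¹(hsieh(C)) · Ω_p^{4n} = ι'⁻¹(hsieh(1)) · u^{4n}`
  have hcinv : (((c⁻¹ : (unrIntegers 3)ˣ) : unrIntegers 3) : ℂ_[3]) *
      ((c : unrIntegers 3) : ℂ_[3]) = 1 := by
    rw [← Subring.coe_mul, ← Units.val_mul, inv_mul_cancel, Units.val_one, Subring.coe_one]
  have hval : ((ι'.symm (hsiehInterpolationValue 3 f 𝔭 χ n A ΩK 1) : PadicAlgCl 3) : ℂ_[3]) *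
        ((u : unrIntegers 3) : ℂ_[3]) ^ (4 * n) =
      (((c⁻¹ : (unrIntegers 3)ˣ) : unrIntegers 3) : ℂ_[3]) *
        ((((ι'.symm (hsiehInterpolationValue 3 f 𝔭 χ n A ΩK C) : PadicAlgCl 3) : ℂ_[3])) *
          Ωp ^ (4 * n)) := by
    rw [hsiehInterpolationValue_const 3 f 𝔭 χ n A ΩK C, map_mul, UniformSpace.Completion.coe_mul,
      ← hc, ← hu]
    rw [show (((c⁻¹ : (unrIntegers 3)ˣ) : unrIntegers 3) : ℂ_[3]) *
          (((c : unrIntegers 3) : ℂ_[3]) *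
            (((ι'.symm (hsiehInterpolationValue 3 f 𝔭 χ n A ΩK 1) : PadicAlgCl 3) : ℂ_[3])) *
            ((u : unrIntegers 3) : ℂ_[3]) ^ (4 * n)) =
        ((((c⁻¹ : (unrIntegers 3)ˣ) : unrIntegers 3) : ℂ_[3]) * ((c : unrIntegers 3) : ℂ_[3])) *
          ((((ι'.symm (hsiehInterpolationValue 3 f 𝔭 χ n A ΩK 1) : PadicAlgCl 3) : ℂ_[3])) *
            ((u : unrIntegers 3) : ℂ_[3]) ^ (4 * n)) by ring, hcinv, one_mul]
  unfold UnrSeries.HasValueAt at hscaled ⊢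
  rw [hfun, hval]
  exact hscaled

end Glue

end Summit.BirchSwinnertonDyer.Rank1Residual.X11b.Three

end
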